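import Summits.BirchSwinnertonDyer.BirchSwinnertonDyer.Theorems.GenusKolyvaginAtTwoEquivariantKolyvaginExactAtTwoTwistInfRes
import Summits.BirchSwinnertonDyer.BirchSwinnertonDyer.Theorems.GenusKolyvaginAtTwoEquivariantKolyvaginExactAtTwoDescent
import HarnessLib

/-!
# Route `GenusKolyvaginAtTwo`, LINE 6, KEY crux Q3 `EquivariantKolyvaginExactAtTwo`
# (stmt-BirchSwinnertonDyer-24882): INFLATION–RESTRICTION IN INDEX `2` BEYOND `M^N = 0` —
# `res : H¹(G, M) → H¹(N, M)` is injective as soon as `H¹(G/N, M^N) = 0` (PROVED)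

Helper (seat `bsd-line-gk2-p3` g10, cell `bsd-f1-sign2`; `--supports` the item, closes nothing): the
GENERIC kernel lemma for stub S6 of the eigen/`ℚ_ℓ` architecture of Q3 (memo Q3-ARCH v2; kernel
status memo Q3-KERNEL-EIGEN v1, evidence #8 on the item), sequel to `…TwistInfRes` (same namespace).

`…TwistInfRes` / att-p4's `InfResSharp` prove injectivity of restriction to a normal subgroup `N`
when `M^N = 0` (the GLOBAL situation `Γ_K ⊂ Γ_ℚ`, `E(K)[2] = 0`). At a Kolyvagin prime `ℓ` (inert in
`K`, level `≥ M`) the LOCAL situation is the opposite extreme: `N = Γ_{K_λ}` acts TRIVIALLY on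
`M = E[2^M] ⊆ E(K_λ)`, and injectivity of `H¹(ℚ_ℓ, E[2^M]) → H¹(K_λ, E[2^M])` comes instead from
`H¹(Gal(K_λ/ℚ_ℓ), E[2^M]) = 0`, true on `Δ(E) < 0` because `E[2^M]` is free of rank one over
`ℤ/2^M[Frob_ℓ = τ]` (Q1; g9's `Gorenstein.exists_eq_sub_tau_of_norm_eq_zero`). This file proves the
index-`2` inflation–restriction injectivity in the generality covering both:

* `resSubgroupH1_injective_of_xor` — `G = N ⊔ N c`, `M` discrete with continuous orbit maps, and
  `H¹(⟨c̄⟩, M^N) = 0` in element form (`a ∈ M^N`, `a + ca = 0 ⟹ a = cb − b`, `b ∈ M^N`) ⟹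
  `res : H¹(G, M) → H¹(N, M)` injective (explicit crossed-homomorphism argument);
* `resSubgroupH1_injective_of_xor_of_trivial` — the case `M^N = M`;
* `resSubgroupH1_injective_of_free` — `M^N = M`, `c² = 1` on `M`, `M` free of rank one over
  `ℤ/2^k[c]` (generator `P`: `hgen`, `hfree`, `2^k P = 0`) ⟹ injective — the S6 kernel: Q2's
  `λ`-adic local orders and Q5′'s `λ`-adic prescriptions are `ℚ_ℓ`-statements on `Δ(E) < 0`.

Left for the sequel: the local-field instantiation (`G = Γ_{ℚ_ℓ}`, `N = galRange K_λ` of index `2`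
for `ℓ` inert, `c` an arithmetic Frobenius acting on `E[2^M]` as `τ` — Gross (3.2) / `FrobEqFrobInfty`).
Everything is PROVED from tree theorems (no named fact, no definition, no `sorry`, standard axioms).
BSD is not proved by any of this.

References: [SerreGaloisCohomology1997] I §2.6 (b); [McCallumLMS1991] §3 (restriction to
`L = K(E_{p^M})` injective), §5 Lemma 5.3; [GrossLMS1991] §4 (`E(K_λ)` at Kolyvagin primes).
-/

set_option autoImplicit false
set_option linter.dupNamespace false -- tree convention: `Summit.BirchSwinnertonDyer.BirchSwinnertonDyer.Theorems` (summit = sub-problem)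

noncomputable section

namespace Summit.BirchSwinnertonDyer.BirchSwinnertonDyer.Theorems.GenusExact.TwistInfRes

open Literature.NumberTheory.EllipticCurves Literature.NumberTheory.GaloisRepresentations

universe u

section IndexTwo

variable {G : Type u} [Group G] [TopologicalSpace G] [IsTopologicalGroup G]
  {N : Subgroup G} [hN : N.Normal] {c : G}
  {M : Type u} [AddCommGroup M] [DistribMulAction G M] [TopologicalSpace M] [DiscreteTopology M]

/-- **Inflation–restriction, injective form, for an index-`2` subgroup with `H¹(G/N, M^N) = 0`.** Let
`N` be normal with `G = N ⊔ N c`, `M` a discrete `G`-module with continuous orbit maps, and suppose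
`H¹(⟨c̄⟩, M^N) = 0` in element form: every `N`-fixed `a` with `a + ca = 0` is `cb − b` for some
`N`-fixed `b`. Then `res : H¹(G, M) → H¹(N, M)` is INJECTIVE. (A kernel cocycle is `φ = ψ + ∂a`
with `ψ|_N = 0`; then `ψ` has `N`-fixed values and `ψ(c) + cψ(c) = ψ(c²) = 0`, so `ψ(c) = cb − b`
and `ψ = ∂b` on `N ∪ Nc = G`.) The tree's `InfResSharp.resOfLe_injective_of_fixedPoints_eq_bot` /
`resSubgroupH1_injective_of_fixedPoints_eq_bot` is the case `M^N = 0`; this version serves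
`M^N = M` — Kolyvagin primes: `G = Γ_{ℚ_ℓ} ⊃ N = Γ_{K_λ}`, `M = E[2^M] ⊆ E(K_λ)`, `c` = Frobenius,
`H¹(K_λ/ℚ_ℓ, E[2^M]) = 0` because `E[2^M]` is free over `ℤ/2^M[Frob]` on `Δ(E) < 0`
(g9's `Gorenstein.exists_eq_sub_tau_of_norm_eq_zero`). [cite: SerreGaloisCohomology1997, I §2.6 (b)]
[cite: McCallumLMS1991, §3 (restriction H¹(K, E_{p^M}) → H¹(L, E_{p^M}) is injective)] -/
theorem resSubgroupH1_injective_of_xor (hxor : ∀ b : G, Xor (b * c⁻¹ ∈ N) (b ∈ N))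
    (hcont : ∀ m : M, Continuous fun g : G ↦ g • m)
    (hC2 : ∀ a : M, (∀ n : N, (n : G) • a = a) → a + c • a = 0 →
      ∃ b : M, (∀ n : N, (n : G) • b = b) ∧ a = c • b - b) :
    Function.Injective (resSubgroupH1 N M) := by
  refine (injective_iff_map_eq_zero _).2 fun x hx ↦ ?_
  obtain ⟨φ, rfl⟩ := oneCocycleClass_surjective _ x
  rw [resSubgroupH1_oneCocycleClass] at hx
  obtain ⟨a, ha⟩ := (oneCocycleClass_eq_zero_iff _ _).mp hx
  have ha' : ∀ n : N, φ.1 n = (n : G) • a - a := fun n ↦ by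
    have h := ha n
    rw [resCocycle_apply, discreteTopRep_ρ_apply, Subgroup.smul_def] at h
    exact h
  -- `ψ := φ - ∂a` vanishes on `N`
  set ψ := φ - cobCocycle a (hcont a) with hψ
  have hψN : ∀ n : N, ψ.1 n = 0 := fun n ↦ by
    rw [hψ, sub_apply_val, cobCocycle_apply, ha', sub_self]
  -- the values of `ψ` are `N`-fixed
  have hfix : ∀ (g : G) (n : N), (n : G) • ψ.1 g = ψ.1 g := by
    intro g n
    have h1 : ψ.1 ((n : G) * g) = ψ.1 n + (n : G) • ψ.1 g := cocycle_mul' ψ n g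
    have hmem : g⁻¹ * n * g ∈ N := hN.conj_mem' n n.2 g
    have h2 : ψ.1 (g * (g⁻¹ * n * g)) = ψ.1 g + g • ψ.1 (g⁻¹ * n * g) := cocycle_mul' ψ g _
    have h3 : ψ.1 (g⁻¹ * n * g) = 0 := hψN ⟨_, hmem⟩
    have e : (n : G) * g = g * (g⁻¹ * n * g) := by group
    rw [hψN n, zero_add, e, h2, h3, smul_zero, add_zero] at h1
    exact h1.symm
  -- `ψ(c)` is anti-invariant: `ψ(c) + c ψ(c) = ψ(c²) = 0`
  have hc2 : c * c ∈ N := mul_self_mem_of_xor hxor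
  have hanti : ψ.1 c + c • ψ.1 c = 0 := by
    have h := cocycle_mul' ψ c c
    have h0 : ψ.1 (c * c) = 0 := hψN ⟨c * c, hc2⟩
    rw [h0] at h
    exact h.symm
  obtain ⟨b, hbN, hb⟩ := hC2 (ψ.1 c) (fun n ↦ hfix c n) hanti
  -- `ψ = ∂b` on `G = N ∪ N c`
  have hψb : ∀ g : G, ψ.1 g = g • b - b := by
    intro g
    rcases exists_eq_or_eq_mul hxor g with ⟨n, rfl⟩ | ⟨n, rfl⟩
    · rw [hψN n, hbN n, sub_self]
    · rw [cocycle_mul' ψ n c, hψN n, zero_add, hb, smul_sub, mul_smul, hbN n]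
  -- conclude
  have hφψ : oneCocycleClass _ φ = oneCocycleClass _ ψ := by
    rw [hψ, oneCocycleClass_sub, oneCocycleClass_cobCocycle, sub_zero]
  rw [hφψ]
  exact (oneCocycleClass_eq_zero_iff _ _).mpr ⟨b, fun g ↦ by rw [discreteTopRep_ρ_apply]; exact hψb g⟩

/-- **The case `M^N = M` (trivial `N`-action): `res : H¹(G, M) → H¹(N, M) = Hom_cont(N, M)` is injective
iff-direction `⟸` from `H¹(G/N, M) = 0`** in element form (`a + ca = 0 ⟹ a = cb − b`).
[cite: SerreGaloisCohomology1997, I §2.6 (b)] -/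
theorem resSubgroupH1_injective_of_xor_of_trivial (hxor : ∀ b : G, Xor (b * c⁻¹ ∈ N) (b ∈ N))
    (hcont : ∀ m : M, Continuous fun g : G ↦ g • m) (hMN : ∀ (n : N) (m : M), (n : G) • m = m)
    (hC2 : ∀ a : M, a + c • a = 0 → ∃ b : M, a = c • b - b) :
    Function.Injective (resSubgroupH1 N M) :=
  resSubgroupH1_injective_of_xor hxor hcont fun a _ ha ↦ by
    obtain ⟨b, hb⟩ := hC2 a ha
    exact ⟨b, fun n ↦ hMN n b, hb⟩

/-- **Kolyvagin-prime form: `M` free of rank one over `ℤ/2^M[c]` and fixed by `N` ⟹ `res` injective.**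
With g9's `Gorenstein.exists_eq_sub_tau_of_norm_eq_zero` (`H¹(C₂, A) = 0` for `A` free of rank one over
`R_M = ℤ/2^M[τ]`, hypotheses `hgen`/`hfree` on a generator `P`): if `N` acts trivially on `M`, `c² = 1` on
`M`, and `M` is generated by `P, cP` freely over `ℤ/2^M`, then `res : H¹(G, M) → H¹(N, M)` is injective.
Reading (S6 of the Q3 architecture): at a Kolyvagin prime `ℓ` of level `≥ M` on `Δ(E) < 0`,
`H¹(ℚ_ℓ, E[2^M]) → H¹(K_λ, E[2^M])` is injective (`Frob_ℓ` acts on `E[2^M] = E(K_λ)[2^M]` as `τ`, and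
`E[2^M] ≅ R_M` by Q1), so Q2's `λ`-adic orders and Q5′'s `λ`-adic prescriptions are `ℚ_ℓ`-statements.
[cite: McCallumLMS1991, §3 and §5 Lemma 5.3] [cite: GrossLMS1991, §4 (E(K_λ)[p^M])] -/
theorem resSubgroupH1_injective_of_free (hxor : ∀ b : G, Xor (b * c⁻¹ ∈ N) (b ∈ N))
    (hcont : ∀ m : M, Continuous fun g : G ↦ g • m) (hMN : ∀ (n : N) (m : M), (n : G) • m = m)
    {k : ℕ} {P : M} (hcc : ∀ m : M, c • c • m = m) (hPM : (2 : ℤ) ^ k • P = 0)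
    (hgen : ∀ m : M, ∃ x y : ℤ, m = x • P + y • c • P)
    (hfree : ∀ x y : ℤ, x • P + y • c • P = 0 → (2 : ℤ) ^ k ∣ x ∧ (2 : ℤ) ^ k ∣ y) :
    Function.Injective (resSubgroupH1 N M) := by
  refine resSubgroupH1_injective_of_xor_of_trivial hxor hcont hMN fun a ha ↦ ?_
  obtain ⟨b, hb⟩ := Gorenstein.exists_eq_sub_tau_of_norm_eq_zero (DistribSMul.toAddMonoidHom M c)
    (fun m ↦ hcc m) hPM (fun m ↦ hgen m) (fun x y h ↦ hfree x y h) (a := a) ha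
  refine ⟨-b, ?_⟩
  rw [hb, smul_neg, DistribSMul.toAddMonoidHom_apply]
  abel

end IndexTwo

end Summit.BirchSwinnertonDyer.BirchSwinnertonDyer.Theorems.GenusExact.TwistInfRes

end
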